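import Mathlib
import HarnessLib
import Summits.ValiantsHypothesis.ValiantsHypothesis.Theorems.KPlusLogSqLawWeakLiftingTowerGraftWronskianConjectureWDefs
import Summits.ValiantsHypothesis.ValiantsHypothesis.Theorems.KPlusLogSqLawWeakLiftingTowerGraftWronskianKFourZoneReduction

/-!
# Tower graft line — CONJECTURE W AT `K = 4` BY NAME: the cell law and the zone law each imply `ConjectureWAt 4`

Helper file for LINE (B) `Cruxes/WeakLifting/Lines/tower_graft.lean` (crux `WeakLifting` = stmt-ValiantsHypothesis-19561): the two kernel
reductions of hands g10–g11 restated against the NAMED statement `ConjectureWAt 4` of `…WronskianConjectureWDefs` (p829192).  NO stub is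
claimed; `ConjectureWAt 4` is OPEN.

* `conjectureWAt_four_of_cellLaw` — the fully alternating cell law (orientation `d₀ + d₃ < d₁ + d₂`) implies `ConjectureWAt 4`
  (`…KFourReflect.card_posRoots_wronskian_four_le_four_of_cellLaw`);
* `conjectureWAt_four_of_zoneLaw` — the zone law (≤ 2 zeros below the poles, ≤ 2 above, on the cell) implies `ConjectureWAt 4`
  (`…KFourZoneReduction.card_posRoots_wronskian_four_le_four_of_zoneLaw`).

HONEST FRAMING: nothing on S4/S4f/S5/S5ᴸ, TowerB, `WeakLifting`, Conjecture B, `MatrixDescartes` (18050), `VP ≠ VNP`.  Def-free.  Seat: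
prover leafhand-val-kpluslogsqlaw-1 g11, `--supports stmt-ValiantsHypothesis-19561 --as helper`.  [this work]
-/

-- `Summit.ValiantsHypothesis.ValiantsHypothesis.…` repeats a component by the D-0017 layout
-- (single-conjunct summit), which the `dupNamespace` linter flags; the name is mandated.
set_option linter.dupNamespace false
set_option autoImplicit false

namespace Summit.ValiantsHypothesis.ValiantsHypothesis.Theorems.KPlusLogSqLaw.TowerGraft

open Polynomial Finset
open scoped BigOperators Polynomial

namespace WronskianDevelopable

/-- **the cell law implies Conjecture W at `K = 4`** (by name). [this work] -/
theorem conjectureWAt_four_of_cellLaw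
    (H : ∀ (u v : Fin 4 → ℝ) (d : Fin 4 → ℕ), StrictMono d → d 0 + d 3 < d 1 + d 2 →
      (u 0 * v 1 - u 1 * v 0) * (u 0 * v 2 - u 2 * v 0) < 0 → (u 0 * v 2 - u 2 * v 0) * (u 0 * v 3 - u 3 * v 0) < 0 →
      (u 0 * v 3 - u 3 * v 0) * (u 1 * v 2 - u 2 * v 1) < 0 → (u 1 * v 2 - u 2 * v 1) * (u 1 * v 3 - u 3 * v 1) < 0 →
      (u 1 * v 3 - u 3 * v 1) * (u 2 * v 3 - u 3 * v 2) < 0 →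
      ((wronskian (∑ l, C (u l) * (X : ℝ[X]) ^ d l) (∑ l, C (v l) * (X : ℝ[X]) ^ d l)).roots.toFinset.filter
        (fun x => 0 < x)).card ≤ 4) :
    ConjectureWAt 4 := by
  intro u v d hd
  exact card_posRoots_wronskian_four_le_four_of_cellLaw H u v d hd

/-- **the zone law implies Conjecture W at `K = 4`** (by name). [this work] -/
theorem conjectureWAt_four_of_zoneLaw
    (ZL : ∀ (u v : Fin 4 → ℝ) (d : Fin 4 → ℕ), StrictMono d → d 0 + d 3 < d 1 + d 2 →
      (u 0 * v 1 - u 1 * v 0) * (u 0 * v 2 - u 2 * v 0) < 0 → (u 0 * v 2 - u 2 * v 0) * (u 0 * v 3 - u 3 * v 0) < 0 →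
      (u 0 * v 3 - u 3 * v 0) * (u 1 * v 2 - u 2 * v 1) < 0 → (u 1 * v 2 - u 2 * v 1) * (u 1 * v 3 - u 3 * v 1) < 0 →
      (u 1 * v 3 - u 3 * v 1) * (u 2 * v 3 - u 3 * v 2) < 0 →
      ∀ ρ₁ ρ₂ ρ₃ : ℝ, 0 < ρ₁ → 0 < ρ₂ → 0 < ρ₃ →
        (∑ l, C (u l * v 1 - u 1 * v l) * (X : ℝ[X]) ^ d l).eval ρ₁ = 0 →
        (∑ l, C (u l * v 2 - u 2 * v l) * (X : ℝ[X]) ^ d l).eval ρ₂ = 0 →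
        (∑ l, C (u l * v 3 - u 3 * v l) * (X : ℝ[X]) ^ d l).eval ρ₃ = 0 →
        ((((wronskian (∑ l, C (u l) * (X : ℝ[X]) ^ d l) (∑ l, C (v l) * (X : ℝ[X]) ^ d l)).roots.toFinset.filter
            (fun x => 0 < x)).filter (fun x => x < ρ₁ ∧ x < ρ₂ ∧ x < ρ₃)).card ≤ 2 ∧
         (((wronskian (∑ l, C (u l) * (X : ℝ[X]) ^ d l) (∑ l, C (v l) * (X : ℝ[X]) ^ d l)).roots.toFinset.filter
            (fun x => 0 < x)).filter (fun x => ρ₁ < x ∧ ρ₂ < x ∧ ρ₃ < x)).card ≤ 2)) :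
    ConjectureWAt 4 := by
  intro u v d hd
  exact card_posRoots_wronskian_four_le_four_of_zoneLaw ZL u v d hd

end WronskianDevelopable

end Summit.ValiantsHypothesis.ValiantsHypothesis.Theorems.KPlusLogSqLaw.TowerGraft
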